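import Literature.AlgebraicGeometry.HodgeTheory.PullbackVanishingOnSmoothSubscheme
import Literature.AlgebraicGeometry.HodgeTheory.HardLefschetzComplexification
import Literature.AlgebraicGeometry.Motives.ComplexPointsManifold
import Literature.AlgebraicTopology.SingularHomology.ClopenAdditivity
import Literature.AlgebraicTopology.SingularHomology.WeakEquivalenceHomology
import Literature.Geometry.Kaehler.LefschetzOperator
import HarnessLib

/-!
# Hard Lefschetz and top-degree vanishing for pure-dimensional smooth projective schemes

Family `hodge`, layer `Literature/AlgebraicGeometry/HodgeTheory`. PROOF FILE (theorems only; no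
definition, no named fact — D-0026).

The tree's hard Lefschetz input for the hyperplane class
(`exists_forall_hasHardLefschetzProperty_map`, file `HyperplaneClassHardLefschetzPullback`) and the
top-degree vanishing `ComplexPoints.isZero_singularHomology_of_lt` are stated for smooth projective
VARIETIES (`Motives.IsSmoothProjective n X`: geometrically irreducible). Deligne's invariant cycle
theorem (Voisin II, Thm. 4.18) is printed for an arbitrary smooth projective morphism, whose fibres
are smooth projective schemes of pure dimension but possibly reducible (= disconnected) or empty.
This file removes the irreducibility hypothesis:

* `hasHardLefschetzProperty_of_isClopenPartition` — the hard Lefschetz property of a class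
  `κ ∈ H²(Y; R)` in dimension `n` holds as soon as it holds for the restrictions of `κ` to the pieces
  of a clopen partition of `Y` (additivity `Hᵏ(Y) ≅ ∏ⱼ Hᵏ(Aⱼ)`, Hatcher §3.1 p. 202, and naturality
  of the cup product);
* `isZero_singularHomology_of_isClopenPartition` — `Hₖ(Y) = 0` if `Hₖ` of every piece vanishes
  (Hatcher Prop. 2.6);
* `exists_components_isSmoothProjective` — a complex scheme `X`, smooth of relative dimension `d`
  over `ℂ` and projective, is the disjoint union of its irreducible components `X_Z`, which are open
  and closed subschemes, smooth projective geometrically irreducible `d`-folds, whose complex points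
  form a clopen partition of `X(ℂ)` (Görtz–Wedhorn I Ex. 3.16: the local rings are domains, so the
  components are disjoint and open; SGA1 XII Prop. 2.4 is not needed);
* `hasHardLefschetzProperty_of_smoothOfRelativeDimension` — for such `X` and a closed immersion
  `κ : X ↪ ℙᵐ`, the pull-back `κ^* r₀` of any class `r₀ ∈ H²(ℙᵐ(ℂ); ℂ)` having the hard Lefschetz
  property on every smooth projective subvariety of `ℙᵐ` has the hard Lefschetz property in dimension
  `d` on `X(ℂ)` (Voisin I Thm. 6.25 componentwise);
* `isZero_singularHomology_of_smoothOfRelativeDimension` — `Hₖ(X(ℂ); R) = 0` for `k > 2d`.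

## References

* [VoisinHodgeI2002] C. Voisin, Hodge Theory and Complex Algebraic Geometry I (CUP 2002), Thm. 6.25.
* [VoisinHodgeII2003] C. Voisin, Hodge Theory and Complex Algebraic Geometry II (CUP 2003), Thm. 4.15,
  Rem. 4.16, Thm. 4.18.
* [HatcherAT2002] A. Hatcher, Algebraic Topology (CUP 2002), Prop. 2.6, §3.1 p. 202, Prop. 3.10.
* [GortzWedhorn2020] U. Görtz, T. Wedhorn, Algebraic Geometry I (2nd ed. 2020), Exercise 3.16.
-/

noncomputable section

open CategoryTheory AlgebraicGeometry Set Function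
open Literature.AlgebraicTopology.SingularHomology
open Literature.Geometry.Kaehler
open Literature.AlgebraicTopology.Homotopy

namespace Literature.AlgebraicGeometry.HodgeTheory

open _root_.Topology
open Literature.AlgebraicGeometry.Motives

universe u v w

/-! ### Hard Lefschetz and vanishing glue over clopen partitions -/

section Clopen

variable {Y : Type u} [TopologicalSpace Y] {J : Type w} {A : J → Set Y}

/-- **The hard Lefschetz property glues over a clopen partition.** If `Y = ⨆ⱼ Aⱼ` is a partition
into open subsets and the restriction of `κ ∈ H²(Y; R)` to every piece has the hard Lefschetz property
in dimension `n`, so has `κ`: under the additivity isomorphisms `Hᵏ(Y) ≅ ∏ⱼ Hᵏ(Aⱼ)` (Hatcher §3.1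
p. 202) the iterated Lefschetz operator `Lʲ` of `κ` is the product of those of the `κ|_{Aⱼ}`
(naturality of the cup product, Hatcher Prop. 3.10). [cite: HatcherAT2002, §3.1 p. 202 and Prop. 3.10] -/
theorem hasHardLefschetzProperty_of_isClopenPartition (hA : IsClopenPartition A)
    {R : Type v} [CommRing R] (κ : singularCohomology R R Y 2) (n : ℕ)
    (h : ∀ j, HasHardLefschetzProperty (singularCohomology.map R R (subsetIncl (A j)) 2 κ) n) :
    HasHardLefschetzProperty κ n := by
  intro j k hjk
  have hnat : ∀ (i : J) (a : singularCohomology R R Y k),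
      singularCohomology.map R R (subsetIncl (A i)) (k + 2 * j) (lefschetzPow κ j k a) =
        lefschetzPow (singularCohomology.map R R (subsetIncl (A i)) 2 κ) j k
          (singularCohomology.map R R (subsetIncl (A i)) k a) :=
    fun i a => lefschetzPow_map (subsetIncl (A i)) κ j k a
  constructor
  · rw [injective_iff_map_eq_zero]
    intro a ha
    refine singularCohomology.eq_zero_of_forall_map_subsetIncl_eq_zero (R := R) (M := R) hA fun i => ?_
    refine (injective_iff_map_eq_zero _).1 (h i j k hjk).1 _ ?_
    rw [← hnat i a, ha, map_zero]
  · intro y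
    have hx : ∀ i, ∃ x, lefschetzPow (singularCohomology.map R R (subsetIncl (A i)) 2 κ) j k x =
        singularCohomology.map R R (subsetIncl (A i)) (k + 2 * j) y := fun i => (h i j k hjk).2 _
    choose x hx using hx
    obtain ⟨a, ha⟩ := singularCohomology.exists_forall_map_subsetIncl_eq (R := R) (M := R) hA x
    refine ⟨a, ?_⟩
    rw [← sub_eq_zero]
    refine singularCohomology.eq_zero_of_forall_map_subsetIncl_eq_zero (R := R) (M := R) hA fun i => ?_
    rw [map_sub, hnat i a, ha i, hx i, sub_self]

/-- **Vanishing of homology glues over a clopen partition**: if `Hₙ(Aⱼ; M) = 0` for every piece of a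
clopen partition of `Y`, then `Hₙ(Y; M) = 0` (every class of `Hₙ(Y)` is a finite sum of push-forwards
from the pieces, Hatcher Prop. 2.6). [cite: HatcherAT2002, Prop. 2.6] -/
theorem isZero_singularHomology_of_isClopenPartition (hA : IsClopenPartition A)
    {R : Type v} [CommRing R] {M : Type v} [AddCommGroup M] [Module R M] (n : ℕ)
    (h : ∀ j, Limits.IsZero (singularHomology R M (A j) n)) :
    Limits.IsZero (singularHomology R M Y n) := by
  have hx0 : ∀ (i : J) (z : singularHomology R M (A i) n), z = 0 := fun i z => by
    have h' := congrArg (fun φ : singularHomology R M (A i) n ⟶ singularHomology R M (A i) n => φ z)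
      ((h i).eq_of_src (𝟙 _) 0)
    simpa using h'
  have hall : ∀ y : singularHomology R M Y n, y = 0 := fun y => by
    obtain ⟨S, x, rfl⟩ := singularHomology.exists_eq_sum_map_subsetIncl hA n y
    exact Finset.sum_eq_zero fun i _ => by rw [hx0 i (x i), map_zero]
  haveI : Subsingleton (singularHomology R M Y n) := ⟨fun a b => (hall a).trans (hall b).symm⟩
  exact ModuleCat.isZero_of_subsingleton _

end Clopen

/-! ### The irreducible components of a pure-dimensional smooth projective scheme -/

section PureDimensional

variable {X : SchemeOver ℂ} {d : ℕ}

/-- **Decomposition of a pure-dimensional smooth projective complex scheme into its components.**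
Let `X` be smooth of relative dimension `d` over `ℂ` and projective. Then there are finitely or
infinitely many (in fact finitely many, not recorded) `ℂ`-schemes `E_c` with morphisms `e_c : E_c ⟶ X`
which are at the same time open and closed immersions, each `E_c` a smooth projective geometrically
irreducible variety of dimension `d`, whose images on complex points form a clopen partition of
`X(ℂ)`: the `E_c` are the open subschemes on the irreducible components of `X`, which are open
because the local rings of the smooth `X` are domains (Görtz–Wedhorn I Ex. 3.16) and pairwise
disjoint, closed in `X` hence projective, and irreducible and reduced hence geometrically integral
over the algebraically closed field `ℂ`. The construction is that of the tree's
`complexBetti_map_eq_zero_of_smooth_closedSubscheme`. [cite: GortzWedhorn2020, Exercise 3.16 (p. 117)] -/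
theorem exists_components_isSmoothProjective [SmoothOfRelativeDimension d X.hom]
    (hX : IsProjectiveOver X) :
    ∃ (C : Type) (E : C → SchemeOver ℂ) (e : ∀ c, E c ⟶ X),
      (∀ c, IsSmoothProjective d (E c)) ∧ (∀ c, IsOpenImmersion (e c).left) ∧
        (∀ c, IsClosedImmersion (e c).left) ∧
        IsClopenPartition fun c => Set.range (AlgPoints.map (L := ℂ) (e c)) := by
  classical
  haveI : IsProper X.hom := hX.isProper
  haveI : IsLocallyNoetherian X.left := LocallyOfFiniteType.isLocallyNoetherian X.hom
  have hdom : ∀ x : X.left, IsDomain (X.left.presheaf.stalk x) := fun x ↦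
    isDomain_stalk_of_smoothOfRelativeDimension X.hom d x
  haveI : IsReduced X.left := isReduced_of_smoothOfRelativeDimension X.hom d
  -- the components, as open subschemes
  set C := irreducibleComponents X.left with hC
  have hopen : ∀ Z : C, IsOpen (Z.1 : Set X.left) := fun Z ↦
    isOpen_of_mem_irreducibleComponents_of_isDomain_stalk hdom Z.2
  let U : C → X.left.Opens := fun Z ↦ ⟨Z.1, hopen Z⟩
  let EZ : C → SchemeOver ℂ := fun Z ↦ Over.mk ((U Z).ι ≫ X.hom)
  let eZ : ∀ Z : C, EZ Z ⟶ X := fun Z ↦ Over.homMk (U Z).ι rfl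
  haveI heZopen : ∀ Z : C, IsOpenImmersion (eZ Z).left := fun Z ↦
    inferInstanceAs (IsOpenImmersion (U Z).ι)
  have hrangeZ : ∀ Z : C, Set.range (U Z).ι = (Z.1 : Set X.left) := fun Z ↦ Scheme.Opens.range_ι _
  haveI heZclosed : ∀ Z : C, IsClosedImmersion (eZ Z).left := fun Z ↦ by
    refine IsClosedImmersion.of_isPreimmersion _ ?_
    change IsClosed (Set.range (U Z).ι)
    rw [hrangeZ]
    exact isClosed_of_mem_irreducibleComponents _ Z.2
  -- each component is a smooth projective (geometrically irreducible) variety of dimension `d`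
  have hEZ : ∀ Z : C, IsSmoothProjective d (EZ Z) := by
    intro Z
    have hsm : SmoothOfRelativeDimension d (EZ Z).hom :=
      IsZariskiLocalAtSource.comp (P := @SmoothOfRelativeDimension d) ‹_› (U Z).ι
    have hproj : IsProjectiveOver (EZ Z) :=
      Resolution.isProjectiveOver_of_isClosedImmersion_left (eZ Z) hX
    haveI : IrreducibleSpace (EZ Z).left := by
      change IrreducibleSpace (U Z)
      have hirr : IsIrreducible ((U Z : X.left.Opens) : Set X.left) := Z.2.1
      exact Subtype.irreducibleSpace hirr
    haveI : IsReduced (EZ Z).left := isReduced_of_smoothOfRelativeDimension (EZ Z).hom d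
    haveI : IsIntegral (EZ Z).left := isIntegral_of_irreducibleSpace_of_isReduced _
    haveI := geometricallyIntegral_of_isAlgClosed (EZ Z).hom
    exact ⟨hsm, hproj, inferInstance⟩
  -- the complex points of the components form a clopen partition of `X(ℂ)`
  let A : C → Set (ComplexPoints X) := fun Z ↦ Set.range (AlgPoints.map (L := ℂ) (eZ Z))
  have hArange : ∀ Z : C, A Z = {P : ComplexPoints X | P.pt ∈ (Z.1 : Set X.left)} := by
    intro Z
    change Set.range (AlgPoints.map (L := ℂ) (eZ Z)) = _
    rw [AlgPoints.range_map_of_isOpenImmersion_holds (L := ℂ) (eZ Z)]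
    ext P
    change P.pt ∈ (((U Z).ι.opensRange : X.left.Opens) : Set X.left) ↔ P.pt ∈ (Z.1 : Set X.left)
    rw [Scheme.Opens.opensRange_ι]
    rfl
  have hA : IsClopenPartition A := by
    refine IsClopenPartition.of_pairwise_disjoint (fun Z ↦ ?_) (fun Z₁ Z₂ hne ↦ ?_) ?_
    · exact (AlgPoints.isOpenEmbedding_map_holds (L := ℂ) (eZ Z)).isOpen_range
    · change Disjoint (A Z₁) (A Z₂)
      rw [hArange, hArange, Set.disjoint_left]
      intro P h₁ h₂
      have hd := disjoint_of_mem_irreducibleComponents_of_isOpen Z₁.2 Z₂.2 (hopen Z₂)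
        (fun h ↦ hne (Subtype.ext h))
      exact Set.disjoint_left.mp hd h₁ h₂
    · refine Set.eq_univ_of_forall fun P ↦ Set.mem_iUnion.mpr ?_
      refine ⟨⟨irreducibleComponent P.pt, irreducibleComponent_mem_irreducibleComponents _⟩, ?_⟩
      rw [hArange]
      exact mem_irreducibleComponent
  exact ⟨C, EZ, eZ, hEZ, heZopen, heZclosed, hA⟩

/-- **Hard Lefschetz for a pure-dimensional smooth projective complex scheme.** Let `X` be smooth of
relative dimension `d` over `ℂ` with a closed immersion `κ : X ↪ ℙᵐ` (so `X` is a finite disjoint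
union of smooth projective `d`-folds, possibly empty), and let `r₀ ∈ H²(ℙᵐ(ℂ); ℂ)` be a class whose
pull-back to every smooth projective subvariety of `ℙᵐ` has the hard Lefschetz property (any generator,
`exists_forall_hasHardLefschetzProperty_map`; Voisin I Thm. 6.25). Then `κ^* r₀` has the hard Lefschetz
property in dimension `d` on `X(ℂ)`: componentwise (`exists_components_isSmoothProjective`) and glued
over the clopen partition (`hasHardLefschetzProperty_of_isClopenPartition`). This is the relative
hard Lefschetz input of Voisin II Thm. 4.15 on ONE fibre of a smooth projective morphism.
[cite: VoisinHodgeI2002, Thm. 6.25] [cite: VoisinHodgeII2003, Thm. 4.15 and Rem. 4.16] -/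
theorem hasHardLefschetzProperty_of_smoothOfRelativeDimension [SmoothOfRelativeDimension d X.hom]
    {m : ℕ} (κ : X ⟶ projectiveSpace m ℂ) [IsClosedImmersion κ.left]
    {r₀ : complexBetti (projectiveSpace m ℂ) 2}
    (hr₀ : ∀ {n : ℕ} {Y : SchemeOver ℂ} (_ : IsSmoothProjective n Y)
      (κ' : Y ⟶ projectiveSpace m ℂ) [IsClosedImmersion κ'.left],
      HasHardLefschetzProperty (complexBetti.map κ' 2 r₀) n) :
    HasHardLefschetzProperty (complexBetti.map κ 2 r₀) d := by
  have hX : IsProjectiveOver X := ⟨m, κ, inferInstance⟩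
  obtain ⟨C, E, e, hE, heo, hec, hA⟩ := exists_components_isSmoothProjective (d := d) hX
  refine hasHardLefschetzProperty_of_isClopenPartition hA _ d fun c => ?_
  haveI := heo c
  haveI := hec c
  have hemb := (AlgPoints.isOpenEmbedding_map_holds (L := ℂ) (e c)).isEmbedding
  rw [← hasHardLefschetzProperty_map_homeomorph_iff hemb.toHomeomorph _ d, ← ModuleCat.comp_apply,
    ← singularCohomology.map_comp]
  have hcomp : (subsetIncl (Set.range (AlgPoints.map (L := ℂ) (e c)))).comp
      (hemb.toHomeomorph : C(ComplexPoints (E c), Set.range (AlgPoints.map (L := ℂ) (e c)))) =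
      AlgPoints.mapContinuous (L := ℂ) (e c) :=
    ContinuousMap.ext fun _ ↦ rfl
  rw [hcomp]
  haveI : IsClosedImmersion (e c ≫ κ).left := by rw [Over.comp_left]; infer_instance
  have h := hr₀ (hE c) (e c ≫ κ)
  rwa [complexBetti.map, AlgPoints.mapContinuous_comp, singularCohomology.map_comp,
    ModuleCat.comp_apply] at h

/-- **No homology above the real dimension, pure-dimensional case**: for `X` smooth of relative
dimension `d` over `ℂ` and projective (possibly reducible or empty), `Hₖ(X(ℂ); R) = 0` for `k > 2d`
(componentwise `ComplexPoints.isZero_singularHomology_of_lt`, glued by additivity, Hatcher Prop. 2.6).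
[cite: HatcherAT2002, Prop. 2.6 and Thm. 3.26] -/
theorem isZero_singularHomology_of_smoothOfRelativeDimension [SmoothOfRelativeDimension d X.hom]
    (hX : IsProjectiveOver X) (R : Type v) [CommRing R] {k : ℕ} (hk : 2 * d < k) :
    Limits.IsZero (singularHomology R R (ComplexPoints X) k) := by
  obtain ⟨C, E, e, hE, heo, hec, hA⟩ := exists_components_isSmoothProjective (d := d) hX
  refine isZero_singularHomology_of_isClopenPartition hA k fun c => ?_
  haveI := heo c
  have hemb := (AlgPoints.isOpenEmbedding_map_holds (L := ℂ) (e c)).isEmbedding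
  haveI := isIso_singularHomology_map_of_isWeakHomotopyEquiv R
    (hemb.toHomeomorph : C(ComplexPoints (E c), Set.range (AlgPoints.map (L := ℂ) (e c))))
    (IsWeakHomotopyEquiv.of_homeomorph hemb.toHomeomorph) k
  exact (ComplexPoints.isZero_singularHomology_of_lt (hE c) R R hk).of_iso
    (asIso (singularHomology.map R R
      (hemb.toHomeomorph : C(ComplexPoints (E c), Set.range (AlgPoints.map (L := ℂ) (e c)))) k)).symm

end PureDimensional

end Literature.AlgebraicGeometry.HodgeTheory

end
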